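import Mathlib
import Summits.NavierStokesRegularity.NavierStokesRegularity.Theorems.EulerZoomLiouvillePowerGaugeEulerLiouvilleCollapseEnergy
import HarnessLib

/-!
# Collapse-time energy of classical members of the crux `EulerZoomLiouville.PowerGaugeEulerLiouville`:
# the far-field shell bound from the natural pointwise tails (route №10, item stmt-NavierStokesRegularity-19832)

Helper file (theorems only; `--supports stmt-NavierStokesRegularity-19832`). Seat ns-typeII-p3 (cell
ns-regularity-ideate §B, D-0081).  The collapse-time criterion `CollapseEnergy.eq_zero_of_collapseEnergy_vanishing`
and the DSS energy-saturation stratum `…DSSEnergySaturation` take the Euler flux through the shells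
`R ≤ |y| ≤ 2R` in the integrated form `∫_{R≤|y|≤2R}(|u(τ)|³ + 2|p(τ)||u(τ)|) ≤ K R^β` (`R ≥ R₀(−τ)^γ`, `β < 1`).
This file derives that SHELL HYPOTHESIS from the natural POINTWISE scale-invariant tails of the in-window
candidates — `‖u(τ,y)‖ ≤ C_u |y|^{−(1+ρ)}`, `|p(τ,y)| ≤ C_p |y|^{−(2+2ρ)}` on `|y| ≥ R₀(−τ)^γ` — with
`β = −3ρ` and `K = 8|B̄₁|(C_u³ + 2C_pC_u)`:

* `shell_le_of_pointwise_tail`.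

WHAT THIS IS NOT: not NS, not the crux E — bookkeeping for classical members (`--supports` stmt-19832). [folklore]
-/

noncomputable section

-- the summit and its single problem share the name `NavierStokesRegularity` (D-0017 nested layout)
set_option linter.dupNamespace false

open Set Function Filter Topology MeasureTheory Metric Module
open scoped NNReal ENNReal InnerProductSpace RealInnerProductSpace

namespace Summit.NavierStokesRegularity.NavierStokesRegularity.Theorems.PowerGaugeEulerLiouville.CollapseEnergy

open Literature.Analysis Literature.Analysis.FluidPDE

variable {u : ℝ → EuclideanSpace ℝ (Fin 3) → EuclideanSpace ℝ (Fin 3)} {p : ℝ → EuclideanSpace ℝ (Fin 3) → ℝ}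

/-! ## The shell bound from pointwise scale-invariant tails -/

/-- **The shell hypothesis from the natural pointwise tails.** If `‖u(τ,y)‖ ≤ C_u ‖y‖^{−(1+ρ)}` and
`|p(τ,y)| ≤ C_p ‖y‖^{−(2+2ρ)}` on the far region `‖y‖ ≥ R₀(−τ)^γ` (`R₀, γ, ρ ≥ 0`; the scale-invariant tails of
the in-window candidates, `γ = 1/(2+ρ)`), and the slices are continuous, then for `R ≥ R₀(−τ)^γ`, `R > 0`:
`∫_{R≤|y|≤2R}(|u(τ)|³ + 2|p(τ)||u(τ)|) ≤ 8 V₁ (C_u³ + 2 C_p C_u) R^{−3ρ}`, `V₁ = |B̄₁|` — the shell bound of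
`eq_zero_of_dss_subExtremal` with `β = −3ρ < 1`. [folklore] -/
theorem shell_le_of_pointwise_tail {ρ Cu Cp R₀ γ : ℝ} (hρ : 0 ≤ ρ) (hCu : 0 ≤ Cu) (hCp : 0 ≤ Cp)
    (hcont : ∀ τ : ℝ, τ < 0 → Continuous (u τ) ∧ Continuous (p τ))
    (hut : ∀ τ : ℝ, τ < 0 → ∀ y : EuclideanSpace ℝ (Fin 3), R₀ * (-τ) ^ γ ≤ ‖y‖ →
      ‖u τ y‖ ≤ Cu * ‖y‖ ^ (-(1 + ρ)))
    (hpt : ∀ τ : ℝ, τ < 0 → ∀ y : EuclideanSpace ℝ (Fin 3), R₀ * (-τ) ^ γ ≤ ‖y‖ →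
      |p τ y| ≤ Cp * ‖y‖ ^ (-(2 + 2 * ρ))) :
    ∀ τ : ℝ, τ < 0 → ∀ R : ℝ, 0 < R → R₀ * (-τ) ^ γ ≤ R →
      ∫ x in {y : EuclideanSpace ℝ (Fin 3) | R ≤ ‖y‖ ∧ ‖y‖ ≤ 2 * R},
        (‖u τ x‖ ^ 3 + 2 * |p τ x| * ‖u τ x‖) ≤
        (8 * (volume (closedBall (0 : EuclideanSpace ℝ (Fin 3)) 1)).toReal * (Cu ^ 3 + 2 * Cp * Cu)) *
          R ^ (-(3 * ρ)) := by
  intro τ hτ R hR hRτ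
  set S : Set (EuclideanSpace ℝ (Fin 3)) := {y | R ≤ ‖y‖ ∧ ‖y‖ ≤ 2 * R} with hS
  have hSc : IsCompact S := Calculus.isCompact_shell_closed R (2 * R)
  have hSm : MeasurableSet S := hSc.isClosed.measurableSet
  obtain ⟨huc, hpc⟩ := hcont τ hτ
  -- pointwise bound on the shell
  set M : ℝ := (Cu ^ 3 + 2 * Cp * Cu) * R ^ (-(3 + 3 * ρ)) with hM
  have hpt' : ∀ x ∈ S, ‖u τ x‖ ^ 3 + 2 * |p τ x| * ‖u τ x‖ ≤ M := by
    intro x hx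
    have hxR : R ≤ ‖x‖ := hx.1
    have hx0 : 0 < ‖x‖ := lt_of_lt_of_le hR hxR
    have hfar : R₀ * (-τ) ^ γ ≤ ‖x‖ := hRτ.trans hxR
    have hu1 := hut τ hτ x hfar
    have hp1 := hpt τ hτ x hfar
    have hr1 : ‖x‖ ^ (-(1 + ρ)) ≤ R ^ (-(1 + ρ)) :=
      Real.rpow_le_rpow_of_nonpos hR hxR (by linarith)
    have hr2 : ‖x‖ ^ (-(2 + 2 * ρ)) ≤ R ^ (-(2 + 2 * ρ)) :=
      Real.rpow_le_rpow_of_nonpos hR hxR (by linarith)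
    have hu2 : ‖u τ x‖ ≤ Cu * R ^ (-(1 + ρ)) := hu1.trans (mul_le_mul_of_nonneg_left hr1 hCu)
    have hp2 : |p τ x| ≤ Cp * R ^ (-(2 + 2 * ρ)) := hp1.trans (mul_le_mul_of_nonneg_left hr2 hCp)
    have hA0 : 0 ≤ Cu * R ^ (-(1 + ρ)) := by positivity
    have hB0 : 0 ≤ Cp * R ^ (-(2 + 2 * ρ)) := by positivity
    have h3 : ‖u τ x‖ ^ 3 ≤ (Cu * R ^ (-(1 + ρ))) ^ 3 :=
      pow_le_pow_left₀ (norm_nonneg _) hu2 3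
    have h4 : 2 * |p τ x| * ‖u τ x‖ ≤ 2 * (Cp * R ^ (-(2 + 2 * ρ))) * (Cu * R ^ (-(1 + ρ))) := by
      have := mul_le_mul hp2 hu2 (norm_nonneg _) hB0
      linarith
    have hpow3 : (R ^ (-(1 + ρ))) ^ 3 = R ^ (-(3 + 3 * ρ)) := by
      rw [← Real.rpow_natCast, ← Real.rpow_mul hR.le]; push_cast; ring_nf
    have hpow2 : R ^ (-(2 + 2 * ρ)) * R ^ (-(1 + ρ)) = R ^ (-(3 + 3 * ρ)) := by
      rw [← Real.rpow_add hR]; ring_nf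
    calc ‖u τ x‖ ^ 3 + 2 * |p τ x| * ‖u τ x‖
        ≤ (Cu * R ^ (-(1 + ρ))) ^ 3 + 2 * (Cp * R ^ (-(2 + 2 * ρ))) * (Cu * R ^ (-(1 + ρ))) :=
          add_le_add h3 h4
      _ = Cu ^ 3 * (R ^ (-(1 + ρ))) ^ 3 + 2 * Cp * Cu * (R ^ (-(2 + 2 * ρ)) * R ^ (-(1 + ρ))) := by ring
      _ = M := by rw [hpow3, hpow2, hM]; ring
  -- integrate the constant bound over the shell, inside the ball of radius `2R`
  have hfi : IntegrableOn (fun x => ‖u τ x‖ ^ 3 + 2 * |p τ x| * ‖u τ x‖) S volume := by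
    have hg : Continuous fun x => ‖u τ x‖ ^ 3 + 2 * |p τ x| * ‖u τ x‖ :=
      ((huc.norm).pow 3).add ((continuous_const.mul hpc.abs).mul huc.norm)
    exact hg.continuousOn.integrableOn_compact hSc
  have hSfin : volume S < ⊤ := hSc.measure_lt_top
  have hint : ∫ x in S, (‖u τ x‖ ^ 3 + 2 * |p τ x| * ‖u τ x‖) ≤ ∫ x in S, M :=
    setIntegral_mono_on hfi (integrableOn_const hSfin.ne) hSm hpt'
  have hM0 : 0 ≤ M := by positivity
  have hvolS : (volume S).toReal ≤ (2 * R) ^ 3 * (volume (closedBall (0 : EuclideanSpace ℝ (Fin 3)) 1)).toReal := by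
    have hsub : S ⊆ closedBall (0 : EuclideanSpace ℝ (Fin 3)) (2 * R) := fun y hy => by
      rw [mem_closedBall_zero_iff]; exact hy.2
    have h1 : (volume S).toReal ≤ (volume (closedBall (0 : EuclideanSpace ℝ (Fin 3)) (2 * R))).toReal :=
      ENNReal.toReal_mono (isCompact_closedBall _ _).measure_lt_top.ne (measure_mono hsub)
    rw [Measure.addHaar_closedBall' volume (0 : EuclideanSpace ℝ (Fin 3)) (by positivity : (0 : ℝ) ≤ 2 * R),
      ENNReal.toReal_mul, finrank_euclideanSpace, Fintype.card_fin,
      ENNReal.toReal_ofReal (by positivity)] at h1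
    exact h1
  calc ∫ x in S, (‖u τ x‖ ^ 3 + 2 * |p τ x| * ‖u τ x‖)
      ≤ ∫ x in S, M := hint
    _ = (volume S).toReal * M := by rw [setIntegral_const, smul_eq_mul, measureReal_def]
    _ ≤ (2 * R) ^ 3 * (volume (closedBall (0 : EuclideanSpace ℝ (Fin 3)) 1)).toReal * M :=
        mul_le_mul_of_nonneg_right hvolS hM0
    _ = (8 * (volume (closedBall (0 : EuclideanSpace ℝ (Fin 3)) 1)).toReal * (Cu ^ 3 + 2 * Cp * Cu)) *
          R ^ (-(3 * ρ)) := by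
        have hR3nat : R ^ (3 : ℝ) = R ^ (3 : ℕ) := by
          rw [show (3 : ℝ) = ((3 : ℕ) : ℝ) by norm_num, Real.rpow_natCast]
        have hR3 : (2 * R) ^ 3 * R ^ (-(3 + 3 * ρ)) = 8 * R ^ (-(3 * ρ)) := by
          have h' : R ^ (-(3 * ρ)) = R ^ (3 : ℝ) * R ^ (-(3 + 3 * ρ)) := by
            rw [← Real.rpow_add hR]; ring_nf
          rw [h', hR3nat]
          ring
        rw [hM]
        calc (2 * R) ^ 3 * (volume (closedBall (0 : EuclideanSpace ℝ (Fin 3)) 1)).toReal *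
              ((Cu ^ 3 + 2 * Cp * Cu) * R ^ (-(3 + 3 * ρ)))
            = (volume (closedBall (0 : EuclideanSpace ℝ (Fin 3)) 1)).toReal * (Cu ^ 3 + 2 * Cp * Cu) *
                ((2 * R) ^ 3 * R ^ (-(3 + 3 * ρ))) := by ring
          _ = _ := by rw [hR3]; ring

end Summit.NavierStokesRegularity.NavierStokesRegularity.Theorems.PowerGaugeEulerLiouville.CollapseEnergy

end
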